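import Summits.AnomalousDissipation.AnomalousDissipation.Theorems.MomentParityQuarticGateHelicity
import Literature.Analysis.FluidPDE.BeltramiWavesCurl
import Literature.Analysis.FluidPDE.NSGalerkinFourier
import Literature.Analysis.FluidPDE.SteadyGalerkinApprox
import Literature.Analysis.FluidPDE.StatisticalSolutionProofs
import Literature.Analysis.FunctionSpaces.TorusFourierModes
import Literature.Analysis.FunctionSpaces.TorusSpectralWeakDerivative

/-!
# Rows of the Galerkin generator at a trigonometric-polynomial atom, in Fourier variables

Helper file for stub S6 (`stub_order2Design`) of the line `recession-cone` of crux
`MomentParity.QuarticGate`. An atom of the order-2 design is an element `U ∈ H` of the energy space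
represented by a real trigonometric polynomial `w = realTrigPoly S c` over the punctured ball
`S = (freqBall N).erase 0` with conjugate-symmetric, transversal coefficients `c`. For such `U` this
file expresses, as FINITE SUMS over `S` of the coefficients: the level-`N` property, `P_N U = w`,
`‖U‖²`, `‖∇U‖²`, pairings `(U, g)`, the inertial pairing `∫ (U ⊗ U) : ∇g` against a band test
(through the convection symbol), hence the LINEAR ROW `⟨F(U), g⟩`, the ENERGY ROW
`⟨F(U), P_N U⟩ = (f, w) - ν‖∇w‖²` and the HELICITY ROW `⟨F(U), curl P_N U⟩` (no cubic term, by
`helicity_inertialPairing_curl`).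
-/

namespace Summit.AnomalousDissipation.AnomalousDissipation.Theorems.MomentParityQuarticGate

open MeasureTheory Filter Complex
open scoped InnerProductSpace RealInnerProductSpace ComplexConjugate ENNReal
open Literature.Analysis.FunctionSpaces Literature.Analysis.FluidPDE

set_option linter.dupNamespace false

section Atom

variable {N : ℕ} {c : (Fin 3 → ℤ) → EuclideanSpace ℂ (Fin 3)}

/-- **The atom as an element of the energy space**: a real trigonometric polynomial over the
punctured ball with transversal coefficients is smooth, divergence free and mean zero, so its
`L²` class lies in `H`. [folklore] -/
theorem exists_energySpace_coe_ae_eq_realTrigPoly (N : ℕ) (c : (Fin 3 → ℤ) → EuclideanSpace ℂ (Fin 3))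
    (hT : Torus.IsTransversal ((Torus.freqBall N).erase 0) c) :
    ∃ U : Torus.energySpace (Fin 3),
      ((U.1 : Lp (EuclideanSpace ℝ (Fin 3)) 2 (volume : Measure (UnitAddTorus (Fin 3)))) :
        UnitAddTorus (Fin 3) → EuclideanSpace ℝ (Fin 3)) =ᵐ[volume]
        Torus.realTrigPoly ((Torus.freqBall N).erase 0) c := by
  set w := Torus.realTrigPoly ((Torus.freqBall N).erase 0) c with hw
  have hs : Torus.IsSmooth w := Torus.isSmooth_realTrigPoly _ _
  have h0 : (0 : Fin 3 → ℤ) ∉ (Torus.freqBall N).erase 0 := fun h => (Finset.mem_erase.1 h).1 rfl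
  exact ⟨⟨(hs.memLp 2).toLp w, Torus.smoothSolenoidal_subset_energySpace ⟨w, hs,
    Torus.isDivFree_realTrigPoly hT, hasZeroMean_realTrigPoly_of_zero_not_mem h0 c,
    MemLp.coeFn_toLp _⟩⟩, MemLp.coeFn_toLp (hs.memLp 2)⟩

variable {U : Torus.energySpace (Fin 3)}
  (hc : Torus.IsConjSymm c)
  (hU : ((U.1 : Lp (EuclideanSpace ℝ (Fin 3)) 2 (volume : Measure (UnitAddTorus (Fin 3)))) :
        UnitAddTorus (Fin 3) → EuclideanSpace ℝ (Fin 3)) =ᵐ[volume]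
        Torus.realTrigPoly ((Torus.freqBall N).erase 0) c)

include hU in
/-- Fourier coefficients of the atom: `c` on the punctured ball, `0` outside. [folklore] -/
theorem mFourierCoeff_coe_of_ae_eq (hc : Torus.IsConjSymm c) (k : Fin 3 → ℤ) :
    UnitAddTorus.mFourierCoeff (EuclideanSpace.complexify ∘
      ((U.1 : Lp (EuclideanSpace ℝ (Fin 3)) 2 (volume : Measure (UnitAddTorus (Fin 3)))) :
        UnitAddTorus (Fin 3) → EuclideanSpace ℝ (Fin 3))) k =
      if k ∈ (Torus.freqBall N).erase 0 then c k else 0 := by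
  rw [Torus.mFourierCoeff_eq_integral_volume,
    integral_congr_ae (hU.mono fun x hx => by simp only [Function.comp_apply, hx]
      : (fun x => (UnitAddTorus.mFourier (-k) x : ℂ) • (EuclideanSpace.complexify ∘
          ((U.1 : Lp (EuclideanSpace ℝ (Fin 3)) 2 (volume : Measure (UnitAddTorus (Fin 3)))) :
            UnitAddTorus (Fin 3) → EuclideanSpace ℝ (Fin 3))) x) =ᵐ[volume]
        fun x => (UnitAddTorus.mFourier (-k) x : ℂ) • (EuclideanSpace.complexify ∘
          Torus.realTrigPoly ((Torus.freqBall N).erase 0) c) x),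
    ← Torus.mFourierCoeff_eq_integral_volume,
    Torus.mFourierCoeff_realTrigPoly neg_mem_freqBall_erase_zero hc]

include hU in
/-- **The atom is a level-`N` field.** [folklore] -/
theorem level_of_ae_eq (hc : Torus.IsConjSymm c) :
    ∀ k ∉ (Torus.freqBall N).erase (0 : Fin 3 → ℤ),
      UnitAddTorus.mFourierCoeff (EuclideanSpace.complexify ∘
        ((U.1 : Lp (EuclideanSpace ℝ (Fin 3)) 2 (volume : Measure (UnitAddTorus (Fin 3)))) :
          UnitAddTorus (Fin 3) → EuclideanSpace ℝ (Fin 3))) k = 0 := fun k hk => by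
  rw [mFourierCoeff_coe_of_ae_eq hU hc, if_neg hk]

include hU in
/-- **The truncation of the atom is its polynomial representative**: `P_N U = w`. [folklore] -/
theorem fourierTruncate_of_ae_eq (hc : Torus.IsConjSymm c) :
    Torus.fourierTruncate N (((U.1 : Lp (EuclideanSpace ℝ (Fin 3)) 2
        (volume : Measure (UnitAddTorus (Fin 3)))) : UnitAddTorus (Fin 3) → EuclideanSpace ℝ (Fin 3))) =
      Torus.realTrigPoly ((Torus.freqBall N).erase 0) c := by
  rw [Torus.fourierTruncate_eq]
  simp_rw [mFourierCoeff_coe_of_ae_eq hU hc]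
  rw [Torus.realTrigPoly_eq_comp, Torus.realTrigPoly_eq_comp,
    Torus.trigPoly_subset (Finset.erase_subset 0 (Torus.freqBall N)) (fun k _ hk => if_neg hk)]
  congr 1
  exact Torus.trigPoly_congr fun k hk => if_pos hk

include hU in
/-- **Energy of the atom**: `‖U‖² = ∑_{k∈S} ‖c k‖²`. [folklore] -/
theorem norm_sq_of_ae_eq (hc : Torus.IsConjSymm c) :
    ‖U‖ ^ 2 = ∑ k ∈ (Torus.freqBall N).erase 0, ‖c k‖ ^ 2 := by
  have h : ‖U‖ = ‖(U.1 : Lp (EuclideanSpace ℝ (Fin 3)) 2 (volume : Measure (UnitAddTorus (Fin 3))))‖ := rfl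
  rw [h, ← Torus.integral_norm_sq_coe_eq,
    ← Torus.integral_norm_sq_realTrigPoly neg_mem_freqBall_erase_zero hc]
  exact integral_congr_ae (hU.mono fun x hx => by simp [hx])

include hU in
/-- **Enstrophy of the atom**: `‖∇U‖² = 4π² ∑_{k∈S} |k|² ‖c k‖²` (spectral, in `ℝ≥0∞`). [folklore] -/
theorem eGradNormSq_of_ae_eq (hc : Torus.IsConjSymm c) :
    Torus.eGradNormSq (((U.1 : Lp (EuclideanSpace ℝ (Fin 3)) 2
        (volume : Measure (UnitAddTorus (Fin 3)))) : UnitAddTorus (Fin 3) → EuclideanSpace ℝ (Fin 3))) =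
      ENNReal.ofReal (4 * Real.pi ^ 2 *
        ∑ k ∈ (Torus.freqBall N).erase 0, Torus.freqNormSq k * ‖c k‖ ^ 2) := by
  rw [← Torus.eGradNormSq_realTrigPoly neg_mem_freqBall_erase_zero hc, Torus.eGradNormSq_eq_tsum,
    Torus.eGradNormSq_eq_tsum]
  simp_rw [mFourierCoeff_coe_of_ae_eq hU hc, Torus.mFourierCoeff_realTrigPoly neg_mem_freqBall_erase_zero hc]

include hU in
/-- **Pairings of the atom** with an `L²` field: `(U, g) = ∑_{k∈S} Re ⟪c k, ĝ k⟫`. [folklore] -/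
theorem pairing_of_ae_eq {g : UnitAddTorus (Fin 3) → EuclideanSpace ℝ (Fin 3)} (hg : MemLp g 2 volume) :
    Torus.pairing (U.1 : Lp (EuclideanSpace ℝ (Fin 3)) 2 (volume : Measure (UnitAddTorus (Fin 3)))) g =
      ∑ k ∈ (Torus.freqBall N).erase 0,
        (inner ℂ (c k) (UnitAddTorus.mFourierCoeff (EuclideanSpace.complexify ∘ g) k)).re := by
  unfold Torus.pairing
  rw [integral_congr_ae (hU.mono fun x hx => by simp only [hx] :
      (fun x => ⟪(((U.1 : Lp (EuclideanSpace ℝ (Fin 3)) 2 (volume : Measure (UnitAddTorus (Fin 3)))) :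
          UnitAddTorus (Fin 3) → EuclideanSpace ℝ (Fin 3)) x), g x⟫_ℝ) =ᵐ[volume]
        fun x => ⟪Torus.realTrigPoly ((Torus.freqBall N).erase 0) c x, g x⟫_ℝ)]
  exact Torus.integral_inner_realTrigPoly_of_integrable_left _ c (hg.integrable one_le_two)


include hU in
/-- **The Stokes term of the atom against a smooth field**: `∫ ⟪U, Δg⟫ = ∑_{k∈S} Re ⟪-4π²|k|² c k, ĝ k⟫`
(`∫ ⟪w, Δg⟫ = ∫ ⟪Δw, g⟫` and `Δ` is the Fourier multiplier `-4π²|k|²`). [folklore] -/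
theorem integral_inner_laplacian_of_ae_eq {g : UnitAddTorus (Fin 3) → EuclideanSpace ℝ (Fin 3)}
    (hg : Torus.IsSmooth g) :
    ∫ x, ⟪(((U.1 : Lp (EuclideanSpace ℝ (Fin 3)) 2 (volume : Measure (UnitAddTorus (Fin 3)))) :
        UnitAddTorus (Fin 3) → EuclideanSpace ℝ (Fin 3)) x), Torus.laplacian g x⟫_ℝ =
      ∑ k ∈ (Torus.freqBall N).erase 0,
        (inner ℂ (-(((4 * Real.pi ^ 2 * Torus.freqNormSq k : ℝ) : ℂ) • c k))
          (UnitAddTorus.mFourierCoeff (EuclideanSpace.complexify ∘ g) k)).re := by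
  have hw : Torus.IsSmooth (Torus.realTrigPoly ((Torus.freqBall N).erase 0) c) :=
    Torus.isSmooth_realTrigPoly _ _
  rw [integral_congr_ae (hU.mono fun x hx => by simp only [hx] :
      (fun x => ⟪(((U.1 : Lp (EuclideanSpace ℝ (Fin 3)) 2 (volume : Measure (UnitAddTorus (Fin 3)))) :
          UnitAddTorus (Fin 3) → EuclideanSpace ℝ (Fin 3)) x), Torus.laplacian g x⟫_ℝ) =ᵐ[volume]
        fun x => ⟪Torus.realTrigPoly ((Torus.freqBall N).erase 0) c x, Torus.laplacian g x⟫_ℝ),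
    ← Torus.integral_inner_laplacian_comm hw hg]
  simp_rw [Torus.laplacian_realTrigPoly]
  exact Torus.integral_inner_realTrigPoly_of_integrable_left _ _ hg.integrable

include hU in
/-- **The inertial pairing of the atom against a band test, in Fourier variables**:
`∫ (U ⊗ U) : ∇g = ∫ ⟪(w·∇)g, w⟫ = -∫ ⟪(w·∇)w, g⟫ = -∑_{k∈S} Re ⟪convectionCoeff S c c k, ĝ k⟫`
(antisymmetry of the trilinear form for the divergence-free `w`; finite Parseval because `g` is
band-limited to `S`). [folklore] -/
theorem inertialPairing_of_ae_eq (hc : Torus.IsConjSymm c)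
    (hT : Torus.IsTransversal ((Torus.freqBall N).erase 0) c)
    {g : UnitAddTorus (Fin 3) → EuclideanSpace ℝ (Fin 3)} (hg : Torus.IsSmooth g)
    (hband : ∀ k ∉ (Torus.freqBall N).erase (0 : Fin 3 → ℤ),
      UnitAddTorus.mFourierCoeff (EuclideanSpace.complexify ∘ g) k = 0) :
    Torus.inertialPairing (U.1 : Lp (EuclideanSpace ℝ (Fin 3)) 2 (volume : Measure (UnitAddTorus (Fin 3)))) g =
      -∑ k ∈ (Torus.freqBall N).erase 0,
        (inner ℂ (Torus.convectionCoeff ((Torus.freqBall N).erase 0) c c k)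
          (UnitAddTorus.mFourierCoeff (EuclideanSpace.complexify ∘ g) k)).re := by
  set w := Torus.realTrigPoly ((Torus.freqBall N).erase 0) c with hw_def
  have hw : Torus.IsSmooth w := Torus.isSmooth_realTrigPoly _ _
  have hdiv : Torus.IsDivFree w := Torus.isDivFree_realTrigPoly hT
  unfold Torus.inertialPairing
  rw [integral_congr_ae (hU.mono fun x hx => by simp only [hx, Torus.convect] :
      (fun x => ⟪Torus.fderiv g x ((((U.1 : Lp (EuclideanSpace ℝ (Fin 3)) 2
          (volume : Measure (UnitAddTorus (Fin 3)))) : UnitAddTorus (Fin 3) → EuclideanSpace ℝ (Fin 3)) x)),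
          (((U.1 : Lp (EuclideanSpace ℝ (Fin 3)) 2 (volume : Measure (UnitAddTorus (Fin 3)))) :
            UnitAddTorus (Fin 3) → EuclideanSpace ℝ (Fin 3)) x)⟫_ℝ) =ᵐ[volume]
        fun x => ⟪Torus.convect w g x, w x⟫_ℝ),
    Torus.integral_inner_convect_eq_neg hw hdiv hg hw]
  congr 1
  rw [integral_congr_ae (ae_of_all _ fun x => real_inner_comm (Torus.convect w w x) (g x) :
      (fun x => ⟪g x, Torus.convect w w x⟫_ℝ) =ᵐ[volume] fun x => ⟪Torus.convect w w x, g x⟫_ℝ),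
    Torus.integral_inner_eq_sum_of_band_limited ((hw.convect hw).memLp 2) (hg.memLp 2) hband]
  refine Finset.sum_congr rfl fun k _ => ?_
  rw [hw_def, Torus.mFourierCoeff_convect_realTrigPoly neg_mem_freqBall_erase_zero hc hc]

include hU in
/-- **THE LINEAR ROW of the atom**, for a smooth band test `g` and an `L²` force:
`⟨F(U), g⟩ = ∫⟪f, g⟫ + ν ∑_{k∈S} Re⟪-4π²|k|² c k, ĝ k⟫ - ∑_{k∈S} Re⟪convectionCoeff S c c k, ĝ k⟫`.
[folklore] -/
theorem nsGeneratorPairing_of_ae_eq (hc : Torus.IsConjSymm c)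
    (hT : Torus.IsTransversal ((Torus.freqBall N).erase 0) c) (ν : ℝ)
    (f : UnitAddTorus (Fin 3) → EuclideanSpace ℝ (Fin 3))
    {g : UnitAddTorus (Fin 3) → EuclideanSpace ℝ (Fin 3)} (hg : Torus.IsSmooth g)
    (hband : ∀ k ∉ (Torus.freqBall N).erase (0 : Fin 3 → ℤ),
      UnitAddTorus.mFourierCoeff (EuclideanSpace.complexify ∘ g) k = 0) :
    Torus.nsGeneratorPairing ν f U g =
      (∫ x, ⟪f x, g x⟫_ℝ) +
        ν * ∑ k ∈ (Torus.freqBall N).erase 0,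
          (inner ℂ (-(((4 * Real.pi ^ 2 * Torus.freqNormSq k : ℝ) : ℂ) • c k))
            (UnitAddTorus.mFourierCoeff (EuclideanSpace.complexify ∘ g) k)).re -
        ∑ k ∈ (Torus.freqBall N).erase 0,
          (inner ℂ (Torus.convectionCoeff ((Torus.freqBall N).erase 0) c c k)
            (UnitAddTorus.mFourierCoeff (EuclideanSpace.complexify ∘ g) k)).re := by
  unfold Torus.nsGeneratorPairing
  rw [integral_inner_laplacian_of_ae_eq hU hg, inertialPairing_of_ae_eq hU hc hT hg hband]
  ring

include hU in
/-- **THE ENERGY ROW of the atom**: `⟨F(U), P_N U⟩ = ∑_{k∈S} Re⟪f̂ k, c k⟫ - ν 4π² ∑_{k∈S} |k|² ‖c k‖²`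
(`P_N U = w`, `∫ ⟪(w·∇)w, w⟫ = 0`, `∫⟪w, Δw⟫ = -‖∇w‖²`). [folklore] -/
theorem nsGeneratorPairing_fourierTruncate_of_ae_eq (hc : Torus.IsConjSymm c)
    (hT : Torus.IsTransversal ((Torus.freqBall N).erase 0) c) (ν : ℝ)
    {f : UnitAddTorus (Fin 3) → EuclideanSpace ℝ (Fin 3)} (hf : Integrable f volume) :
    Torus.nsGeneratorPairing ν f U (Torus.fourierTruncate N
      (((U.1 : Lp (EuclideanSpace ℝ (Fin 3)) 2 (volume : Measure (UnitAddTorus (Fin 3)))) :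
        UnitAddTorus (Fin 3) → EuclideanSpace ℝ (Fin 3)))) =
      (∑ k ∈ (Torus.freqBall N).erase 0,
        (inner ℂ (UnitAddTorus.mFourierCoeff (EuclideanSpace.complexify ∘ f) k) (c k)).re) -
        ν * (4 * Real.pi ^ 2 * ∑ k ∈ (Torus.freqBall N).erase 0, Torus.freqNormSq k * ‖c k‖ ^ 2) := by
  set w := Torus.realTrigPoly ((Torus.freqBall N).erase 0) c with hw_def
  have hw : Torus.IsSmooth w := Torus.isSmooth_realTrigPoly _ _
  have hdiv : Torus.IsDivFree w := Torus.isDivFree_realTrigPoly hT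
  rw [fourierTruncate_of_ae_eq hU hc]
  unfold Torus.nsGeneratorPairing
  rw [integral_inner_laplacian_of_ae_eq hU hw, Torus.integral_inner_realTrigPoly_of_integrable _ _ hf]
  have hin : Torus.inertialPairing (U.1 : Lp (EuclideanSpace ℝ (Fin 3)) 2
      (volume : Measure (UnitAddTorus (Fin 3)))) w = 0 := by
    unfold Torus.inertialPairing
    rw [integral_congr_ae (hU.mono fun x hx => by simp only [hx, Torus.convect] :
      (fun x => ⟪Torus.fderiv w x ((((U.1 : Lp (EuclideanSpace ℝ (Fin 3)) 2
          (volume : Measure (UnitAddTorus (Fin 3)))) : UnitAddTorus (Fin 3) → EuclideanSpace ℝ (Fin 3)) x)),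
          (((U.1 : Lp (EuclideanSpace ℝ (Fin 3)) 2 (volume : Measure (UnitAddTorus (Fin 3)))) :
            UnitAddTorus (Fin 3) → EuclideanSpace ℝ (Fin 3)) x)⟫_ℝ) =ᵐ[volume]
        fun x => ⟪Torus.convect w w x, w x⟫_ℝ)]
    exact Torus.integral_inner_convect_self_eq_zero hw hdiv
  rw [← hw_def, hin, add_zero]
  simp_rw [hw_def, Torus.mFourierCoeff_realTrigPoly neg_mem_freqBall_erase_zero hc]
  rw [Finset.mul_sum, Finset.mul_sum, Finset.mul_sum, ← Finset.sum_sub_distrib, ← Finset.sum_add_distrib]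
  refine Finset.sum_congr rfl fun k hk => ?_
  have hself : (⟪c k, c k⟫_ℂ).re = ‖c k‖ ^ 2 := by
    have := inner_self_eq_norm_sq (𝕜 := ℂ) (c k)
    rwa [RCLike.re_to_complex] at this
  rw [if_pos hk, inner_neg_left, inner_smul_left, Complex.conj_ofReal, Complex.neg_re, Complex.re_ofReal_mul,
    hself]
  ring

include hU in
/-- **THE HELICITY ROW of the atom**: `⟨F(U), curl P_N U⟩ = ∑_{k∈S} Re⟪f̂ k, curlCoeff c k⟫ +
ν ∑_{k∈S} Re⟪c k, -4π²|k|² curlCoeff c k⟫` — no cubic term (`helicity_inertialPairing_curl`).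
[folklore] -/
theorem nsGeneratorPairing_curl_fourierTruncate_of_ae_eq (hc : Torus.IsConjSymm c)
    (hT : Torus.IsTransversal ((Torus.freqBall N).erase 0) c) (ν : ℝ)
    {f : UnitAddTorus (Fin 3) → EuclideanSpace ℝ (Fin 3)} (hf : Integrable f volume) :
    Torus.nsGeneratorPairing ν f U (BDSV.curl (Torus.fourierTruncate N
      (((U.1 : Lp (EuclideanSpace ℝ (Fin 3)) 2 (volume : Measure (UnitAddTorus (Fin 3)))) :
        UnitAddTorus (Fin 3) → EuclideanSpace ℝ (Fin 3))))) =
      (∑ k ∈ (Torus.freqBall N).erase 0,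
        (inner ℂ (UnitAddTorus.mFourierCoeff (EuclideanSpace.complexify ∘ f) k)
          (IntermittentBeltrami.curlCoeff c k)).re) +
        ν * ∑ k ∈ (Torus.freqBall N).erase 0,
          (inner ℂ (c k) (-(((4 * Real.pi ^ 2 * Torus.freqNormSq k : ℝ) : ℂ) •
            IntermittentBeltrami.curlCoeff c k))).re := by
  have hw : Torus.IsSmooth (Torus.realTrigPoly ((Torus.freqBall N).erase 0) c) :=
    Torus.isSmooth_realTrigPoly _ _
  have hdiv : Torus.IsDivFree (Torus.realTrigPoly ((Torus.freqBall N).erase 0) c) :=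
    Torus.isDivFree_realTrigPoly hT
  have hcurl : BDSV.curl (Torus.realTrigPoly ((Torus.freqBall N).erase 0) c) =
      Torus.realTrigPoly ((Torus.freqBall N).erase 0) (IntermittentBeltrami.curlCoeff c) :=
    funext fun x => IntermittentBeltrami.curl_realTrigPoly _ c x
  have hlapc : Torus.laplacian (Torus.realTrigPoly ((Torus.freqBall N).erase 0)
      (IntermittentBeltrami.curlCoeff c)) = Torus.realTrigPoly ((Torus.freqBall N).erase 0)
        (fun k => -(((4 * Real.pi ^ 2 * Torus.freqNormSq k : ℝ) : ℂ) • IntermittentBeltrami.curlCoeff c k)) :=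
    funext fun x => Torus.laplacian_realTrigPoly _ _ x
  rw [fourierTruncate_of_ae_eq hU hc]
  unfold Torus.nsGeneratorPairing
  rw [helicity_inertialPairing_curl _ _ hw hdiv hU, add_zero, hcurl, hlapc,
    Torus.integral_inner_realTrigPoly_of_integrable _ _ hf]
  rw [integral_congr_ae (hU.mono fun x hx => by simp only [hx] :
      (fun x => ⟪(((U.1 : Lp (EuclideanSpace ℝ (Fin 3)) 2 (volume : Measure (UnitAddTorus (Fin 3)))) :
          UnitAddTorus (Fin 3) → EuclideanSpace ℝ (Fin 3)) x),
          Torus.realTrigPoly ((Torus.freqBall N).erase 0) (fun k =>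
            -(((4 * Real.pi ^ 2 * Torus.freqNormSq k : ℝ) : ℂ) • IntermittentBeltrami.curlCoeff c k)) x⟫_ℝ)
        =ᵐ[volume] fun x => ⟪Torus.realTrigPoly ((Torus.freqBall N).erase 0) c x,
          Torus.realTrigPoly ((Torus.freqBall N).erase 0) (fun k =>
            -(((4 * Real.pi ^ 2 * Torus.freqNormSq k : ℝ) : ℂ) • IntermittentBeltrami.curlCoeff c k)) x⟫_ℝ)]
  rw [Torus.integral_inner_realTrigPoly_of_integrable _ _ hw.integrable]
  have hcoef : ∀ k ∈ (Torus.freqBall N).erase 0,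
      UnitAddTorus.mFourierCoeff (EuclideanSpace.complexify ∘ Torus.realTrigPoly ((Torus.freqBall N).erase 0) c) k
        = c k := fun k hk => by
    rw [Torus.mFourierCoeff_realTrigPoly neg_mem_freqBall_erase_zero hc, if_pos hk]
  congr 1
  congr 1
  exact Finset.sum_congr rfl fun k hk => by rw [hcoef k hk]

end Atom

/-- **Registered sub-goal `atomRows_energyRow` of stub S6** (summary of this file): the ENERGY
ROW of the Galerkin generator at a trigonometric-polynomial atom `U = realTrigPoly S c` a.e.,
`S = (freqBall N).erase 0`, is `(f, w) - ν ‖∇w‖²` in Fourier variables. [folklore] -/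
theorem atomRows_energyRow : ∀ (N : ℕ) (c : (Fin 3 → ℤ) → EuclideanSpace ℂ (Fin 3)) (U : Torus.energySpace (Fin 3)) (ν : ℝ) (f : UnitAddTorus (Fin 3) → EuclideanSpace ℝ (Fin 3)), Torus.IsConjSymm c → Torus.IsTransversal ((Torus.freqBall N).erase 0) c → Integrable f volume → (U.1 : UnitAddTorus (Fin 3) → EuclideanSpace ℝ (Fin 3)) =ᵐ[volume] Torus.realTrigPoly ((Torus.freqBall N).erase 0) c → Torus.nsGeneratorPairing ν f U (Torus.fourierTruncate N (U.1 : UnitAddTorus (Fin 3) → EuclideanSpace ℝ (Fin 3))) = (∑ k ∈ (Torus.freqBall N).erase 0, (inner ℂ (UnitAddTorus.mFourierCoeff (EuclideanSpace.complexify ∘ f) k) (c k)).re) - ν * (4 * Real.pi ^ 2 * ∑ k ∈ (Torus.freqBall N).erase 0, Torus.freqNormSq k * ‖c k‖ ^ 2) :=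
  fun _ _ _ ν _ hc hT hf hU => nsGeneratorPairing_fourierTruncate_of_ae_eq hU hc hT ν hf

end Summit.AnomalousDissipation.AnomalousDissipation.Theorems.MomentParityQuarticGate
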